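import Summits.QuantumFields.BalabanUV.Beta.GAN24.CubicReadoutDecLift
import Summits.QuantumFields.BalabanUV.Beta.CoDressedMmRead
import Summits.QuantumFields.BalabanUV.Beta.AxialDressingRootedBmLinear
import Summits.QuantumFields.BalabanUV.Beta.WardLocusRecursive

/-!
# `BalabanUV.Beta.GAN24.CubicReadoutCoDressed` — binder row G-an2-4 / (CONV-C), S-slot on the RECURSIVE wall family (E) (literal of
# record for binder row D1, an2's X-an2-51 `RowD1JointEnd.JsRowD1`): CO-DRESSING THE STEP RESOLVENT = DRESSING THE STENCILS inside the
# cubic read-out, hence THE CUBIC SECTOR OF EVERY MEMBER OF `WardLocusRecursive.SrecAt` IS A ONE-SHOT level-`(j+1)` `e3OfS` SANDWICH of a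
# lifted, block-mean-dressed copy of the previous member (unit `b2b-balaban-gan24-p1`, gen 12; part 2 of `GAN24/CubicReadoutDecLift`;
# `HOME/b2b-balaban-gan24-p1/S-REC-SIZING.md` v1 §2′, brick (T3-S) «the co-dressing seam on the S-side» of route (E-α))

NOT IN PRINT; OUR BOOKKEEPING.  HONEST FRAMING (cell contract, verbatim): «discharging `BetaPertH` makes Bałaban's UV stability UNCONDITIONAL —
a real constructive-QFT result; it is NOT the continuum limit and NOT the Clay problem.»  HONEST DEPENDENCY (verbatim): «continuum YM on T⁴ ⇐
BetaPertH ∧ nine spine estimates (0/9 proved); BetaPertH ⇐ (D1) ∧ (D4) ∧ CAP+tail; G-an2-4 gates asym, D1 and NE2/3/4.»  [folklore] identities over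
tree theorems BY NAME — an2's block-mean dressing calculus (`AxialDressingRooted.coDressKBmAt = Πᵀ∘K∘Π`, `dressKBmAt = Π∘V∘Πᵀ`, `coProjBmAtK`,
`vertexOfK_dressKBmAt`, `vertexOfK_coProjBmAtK`, `colH_coDressKBmAt_eq`, `mmRead_coDressKBmAt`, `spr_piKBm`, `spr_comp`, `locStencil_coProjBmAtK`,
`locStencil_dressKBmAt`), an2's tame kernel algebra (`TameKernelCalculus.comp_assoc_tame`, `Spr`/`Loc` closure), part 1's exchange
(`CubicReadoutDecLift.e3OfK_KInvStep_eq_e3OfS`) and leaf-10's `WardLocusRecursive.locStencil_SrecAt`.  Generic `d`; NO estimate, NO constant chosen,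
NO cited fact, NO `def`, NO `def … : Prop`, NO wall binder; the reserved families `GAN24.StencilSlotE3*` / `GAN24.WSlotT2*` untouched.  Discharges
NOTHING of (hS, hSall) on (E); NOT BetaPertH, NOT continuum, NOT Clay.

## The findings (kernel-checked below; `Π = piKBm ρ L`, `ρ = toSite r`, `r ∈ box (d+1) L`, `Ĝ = coDressKBmAt ρ L G = Πᵀ∘G∘Π`)
(1) `sandwich_coDressKBmAt`: `Ĝ ∘ V ∘ Ĝ = coDressKBmAt ρ L (G ∘ dressKBmAt ρ L V ∘ G)` (pure associativity of tame kernels), so under the `mm`-read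
    (`mmRead_coDressKBmAt`: `Πᵀ`/`Π` are the identity on multiplier legs) `mmRead N (Ĝ ∘ V ∘ Ĝ) = mmRead N (G ∘ (Π∘V∘Πᵀ) ∘ G)`.
(2) `vertexOfK_dressed_stencils` (an2's vertex transfer `vertexOfK_dressBmAt_S` with the jet datum unbundled): the chain-rule vertex THROUGH `G` of
    the dressed stencil family `𝔇S κ u := dressKBmAt ρ L (coProjBmAtK ρ L S κ u)` is `dressKBmAt ρ L (vertexOfK Ĝ L S)`.
(3) **`e3K_coDressKBmAt`: `e3K Ĝ L S κ′ u′ = e3K G L 𝔇S κ′ u′`** — inside the cubic read-out, CO-DRESSING THE KERNEL IS DRESSING THE STENCILS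
    (exact; any spread `G`, any local `S`).
(4) With `G := KInvStep Lc j` and part 1: **`e3OfK_coDressKBmAt_KInvStep_eq_e3OfS`**:
    `e3OfK Lc (coDressKBmAt ρ Lc (KInvStep Lc j)) S κ′ u′ = e3OfS (Lc^(j+1)) (((Lc^j)^{d+2})⁻¹ • borderSum (Lc^j) 𝔇S) κ′ u′`, and for THE LITERAL:
    **`srecAt_cubic_eq_e3OfS`** — the cubic sector `e3OfK Lc G_j (SrecAt … j)` of member `j+1` of leaf-10's recursive family (the `(cE·wE (j+1)) •`-summand
    of `SrecAt_succ` / `SpineRecursiveW.SpureRecAt`) IS `e3OfS (Lc^(j+1))` of the lifted dressed member `j` — road S3's OUTER object, member by member.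
READING (bookkeeping, not an estimate): the S-slot (hS, hSall) of the literal of record therefore asks for j-UNIFORM locality / Cauchy control of
ONE-SHOT `e3OfS` sandwiches (outer legs = `KInv (Lc^(j+1))`'s own, road P1's K-slot + `ThirdJetKernel`'s generic calculus) of the inner families
`j ↦ ((Lc^j)^{d+2})⁻¹ • borderSum (Lc^j) (𝔇 (SrecAt … j))` — route (E-β) = control them natively (zero-charge transport), route (E-α) = identify
them with the composite family's pushed tables (the `ℋ`-weights compose: `ResolventComposition.k1b'`, `RespStepSemigroup.respStep_semigroup`).
-/

noncomputable section

open Finset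
open scoped BigOperators
open Literature.MathematicalPhysics.QuantumFieldTheory
open Literature.MathematicalPhysics.QuantumFieldTheory.Balaban1983to89
open Literature.MathematicalPhysics.QuantumFieldTheory.Balaban1983to89.Beta
open B12Sec2to5 (l1 l1_nonneg)
open ExpKernelCalculus (MKer Decays BiLoc VertexFamily comp)
open AffineAveraging (box toSite)
open OneStepResolventKernel (Fib LocStencil KInv)
open OneStepKernelFamily (dec KInvStep decays_KInvStep vertexOfK vertexFamily_vertexOfK')
open BalabanStepJetsSucc (mmRead)
open DecLiftAdjoint (borderSum)
open Summit.QuantumFields.BalabanUV.Beta.TameKernelCalculus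
open Summit.QuantumFields.BalabanUV.Beta.AxialDressingRooted (piKBm coDressKBmAt coDressKBmAt_eq dressKBmAt coProjBmAtK spr_piKBm
  spr_trK_piKBm spr_comp spr_coDressKBmAt mmRead_coDressKBmAt vertexOfK_dressKBmAt vertexOfK_coProjBmAtK colH_coDressKBmAt_eq locStencil_coProjBmAtK
  locStencil_dressKBmAt one_le_of_neZero)
open Summit.QuantumFields.BalabanUV.Beta.GAN24.E3UnitSplit (e3OfS)
open Summit.QuantumFields.BalabanUV.Beta.GAN24.ThirdJetKernel (e3K)
open Summit.QuantumFields.BalabanUV.Beta.SpineRooted (e3OfK)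
open Summit.QuantumFields.BalabanUV.Beta.GAN24.CubicReadoutDecLift (e3OfK_eq_e3K e3OfK_KInvStep_eq_e3OfS)
open Summit.QuantumFields.BalabanUV.Beta.WardLocusRecursive (SrecAt locStencil_SrecAt)

namespace Summit.QuantumFields.BalabanUV.Beta.GAN24.CubicReadoutCoDressed

variable {d : ℕ}

/-! ## §1 The co-dressed sandwich is the co-dressing of the dressed sandwich -/

section Sandwich

variable {L : ℕ} {r : Fin (d + 1) → ℕ} {G V : MKer (d + 1) (Fib d)}

/-- [folklore] **THE CO-DRESSED SANDWICH**: `(Πᵀ∘G∘Π) ∘ V ∘ (Πᵀ∘G∘Π) = Πᵀ ∘ (G ∘ (Π∘V∘Πᵀ) ∘ G) ∘ Π`, i.e.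
`comp (comp Ĝ V) Ĝ = coDressKBmAt ρ L (comp (comp G (dressKBmAt ρ L V)) G)` — associativity of composition for tame factors
(`TameKernelCalculus.comp_assoc_tame`; `Π`, `Πᵀ`, `G` spread, `V` localised). -/
theorem sandwich_coDressKBmAt (hL : 1 ≤ L) (hr : r ∈ box (d + 1) L) (hG : Spr G) (hV : Loc V) :
    comp (comp (coDressKBmAt (toSite r) L G) V) (coDressKBmAt (toSite r) L G)
      = coDressKBmAt (toSite r) L (comp (comp G (dressKBmAt (toSite r) L V)) G) := by
  have sP : Spr (piKBm (d := d) (toSite r) L) := spr_piKBm hL hr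
  have sPt : Spr (trK (piKBm (d := d) (toSite r) L)) := spr_trK_piKBm hL hr
  have sPtG : Spr (comp (trK (piKBm (toSite r) L)) G) := spr_comp sPt hG
  have sPtGP : Spr (comp (comp (trK (piKBm (toSite r) L)) G) (piKBm (toSite r) L)) := spr_comp sPtG sP
  have lA : Loc (comp (comp (comp (trK (piKBm (toSite r) L)) G) (piKBm (toSite r) L)) V) := sPtGP.comp_loc hV
  have lPV : Loc (comp (piKBm (toSite r) L) V) := sP.comp_loc hV
  have lW : Loc (comp (comp (piKBm (toSite r) L) V) (trK (piKBm (toSite r) L))) := lPV.comp_spr sPt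
  have lGW : Loc (comp G (comp (comp (piKBm (toSite r) L) V) (trK (piKBm (toSite r) L)))) := hG.comp_loc lW
  have eD : dressKBmAt (toSite r) L V = comp (comp (piKBm (toSite r) L) V) (trK (piKBm (toSite r) L)) := rfl
  rw [coDressKBmAt_eq, coDressKBmAt_eq, eD]
  -- left-hand side to the canonical left-nested form
  rw [comp_assoc_tame lA.tame sPtG.tame sP.tame, comp_assoc_tame lA.tame sPt.tame hG.tame]
  -- right-hand side to the same form
  rw [comp_assoc_tame sPt.tame lGW.tame hG.tame, comp_assoc_tame sPt.tame hG.tame lW.tame,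
    comp_assoc_tame sPtG.tame lPV.tame sPt.tame, comp_assoc_tame sPtG.tame sP.tame hV.tame]

/-- [folklore] **UNDER THE `mm`-READ THE OUTER DRESSING DISAPPEARS**: `mmRead N (Ĝ ∘ V ∘ Ĝ) = mmRead N (G ∘ dressKBmAt ρ L V ∘ G)`
(`sandwich_coDressKBmAt` + an2's `mmRead_coDressKBmAt`: `Πᵀ`, `Π` are the identity on the multiplier legs). -/
theorem mmRead_sandwich_coDressKBmAt (hL : 1 ≤ L) (hr : r ∈ box (d + 1) L) (hG : Spr G) (hV : Loc V) (N : ℕ) :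
    mmRead N (comp (comp (coDressKBmAt (toSite r) L G) V) (coDressKBmAt (toSite r) L G))
      = mmRead N (comp (comp G (dressKBmAt (toSite r) L V)) G) := by
  rw [sandwich_coDressKBmAt hL hr hG hV, mmRead_coDressKBmAt]

end Sandwich

/-! ## §2 Co-dressing the kernel = dressing the stencils, inside the cubic read-out -/

section Exchange

variable {L : ℕ} {r : Fin (d + 1) → ℕ} {G : MKer (d + 1) (Fib d)} {C δG : ℝ}
  {S : Fin (d + 1) → (Fin (d + 1) → ℤ) → MKer (d + 1) (Fib d)} {Cs δ : ℝ}

/-- [folklore] **THE VERTEX TRANSFER, UNBUNDLED** (an2's `vertexOfK_dressBmAt_S` for a bare stencil family): the chain-rule vertex THROUGH `G` of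
the dressed stencils `𝔇S κ u := dressKBmAt ρ L (coProjBmAtK ρ L S κ u)` is the dressing of the vertex through the CO-DRESSED kernel of `S`:
`vertexOfK G L 𝔇S μ y = dressKBmAt ρ L (vertexOfK (coDressKBmAt ρ L G) L S μ y)`. -/
theorem vertexOfK_dressed_stencils (hL : 1 ≤ L) (hr : r ∈ box (d + 1) L) (hG : Decays G C δG) (hδG : 0 < δG)
    (hS : LocStencil S Cs δ) (hδ : 0 < δ) (μ : Fin (d + 1)) (y : Fin (d + 1) → ℤ) :
    vertexOfK G L (fun κ u => dressKBmAt (toSite r) L (coProjBmAtK (toSite r) L S κ u)) μ y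
      = dressKBmAt (toSite r) L (vertexOfK (coDressKBmAt (toSite r) L G) L S μ y) := by
  rw [vertexOfK_dressKBmAt (toSite r) L hG hδG.le (locStencil_coProjBmAtK hL hr hS hδ.le) hδ μ y]
  congr 1
  funext x z a b
  rw [vertexOfK_coProjBmAtK hL hr hG hδG hS hδ.le, ← colH_coDressKBmAt_eq]
  rfl

/-- [folklore] **CO-DRESSING THE KERNEL IS DRESSING THE STENCILS INSIDE THE CUBIC READ-OUT** (exact, as kernels on the coarse lattice):
`e3K (coDressKBmAt ρ L G) L S κ′ u′ = e3K G L (fun κ u => dressKBmAt ρ L (coProjBmAtK ρ L S κ u)) κ′ u′`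
for any spread `G` and any local `S` (`mmRead_sandwich_coDressKBmAt` + `vertexOfK_dressed_stencils`). -/
theorem e3K_coDressKBmAt (hL : 1 ≤ L) (hr : r ∈ box (d + 1) L) (hG : Decays G C δG) (hδG : 0 < δG)
    (hS : LocStencil S Cs δ) (hδ : 0 < δ) (κ' : Fin (d + 1)) (u' : Fin (d + 1) → ℤ) :
    e3K (coDressKBmAt (toSite r) L G) L S κ' u'
      = e3K G L (fun κ u => dressKBmAt (toSite r) L (coProjBmAtK (toSite r) L S κ u)) κ' u' := by
  have sG : Spr G := ⟨C, δG, hδG, hG⟩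
  have sGh : Spr (coDressKBmAt (toSite r) L G) := spr_coDressKBmAt hL hr sG
  -- the vertex through the co-dressed kernel is localised
  have lV : Loc (vertexOfK (coDressKBmAt (toSite r) L G) L S κ' u') := by
    obtain ⟨Ch, δh, hδh, hGh⟩ := sGh
    obtain ⟨Cv, δv, hδv, hV⟩ := vertexFamily_vertexOfK' (N := L) ⟨δh, Ch, hδh, hGh.nonneg (Sum.inl 0), hGh⟩ hS hδ
    exact ⟨_, _, Cv, δv, hδv, hV κ' u'⟩
  funext x z a b
  show -(mmRead L (comp (comp (coDressKBmAt (toSite r) L G) (vertexOfK (coDressKBmAt (toSite r) L G) L S κ' u'))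
      (coDressKBmAt (toSite r) L G)) x z a b) = -(mmRead L (comp (comp G (vertexOfK G L
      (fun κ u => dressKBmAt (toSite r) L (coProjBmAtK (toSite r) L S κ u)) κ' u')) G) x z a b)
  rw [mmRead_sandwich_coDressKBmAt hL hr sG lV, vertexOfK_dressed_stencils hL hr hG hδG hS hδ]

/-- [folklore] The same in an2's spelling `SpineRooted.e3OfK L K S` (`CubicReadoutDecLift.e3OfK_eq_e3K`, `rfl`). -/
theorem e3OfK_coDressKBmAt (hL : 1 ≤ L) (hr : r ∈ box (d + 1) L) (hG : Decays G C δG) (hδG : 0 < δG)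
    (hS : LocStencil S Cs δ) (hδ : 0 < δ) (κ' : Fin (d + 1)) (u' : Fin (d + 1) → ℤ) :
    e3OfK L (coDressKBmAt (toSite r) L G) S κ' u'
      = e3OfK L G (fun κ u => dressKBmAt (toSite r) L (coProjBmAtK (toSite r) L S κ u)) κ' u' := by
  rw [e3OfK_eq_e3K, e3OfK_eq_e3K]
  exact e3K_coDressKBmAt hL hr hG hδG hS hδ κ' u'

end Exchange

/-! ## §3 Bałaban's sockets and the literal of record -/

section Balaban

variable {Lc : ℕ} [NeZero Lc] {r : Fin (d + 1) → ℕ} {S : Fin (d + 1) → (Fin (d + 1) → ℤ) → MKer (d + 1) (Fib d)} {Cs δ : ℝ}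

/-- [folklore] **THE CO-DRESSED STEP READ-OUT IS A ONE-SHOT `e3OfS` ONE LEVEL UP**: for an in-block root `r`, any local level-`j` stencil family `S`,
`e3OfK Lc (coDressKBmAt ρ Lc (KInvStep Lc j)) S κ′ u′ = e3OfS (Lc^(j+1)) (((Lc^j)^{d+2})⁻¹ • borderSum (Lc^j) 𝔇S) κ′ u′`,
`𝔇S κ u := dressKBmAt ρ Lc (coProjBmAtK ρ Lc S κ u)` (`e3OfK_coDressKBmAt` ∘ part 1's `e3OfK_KInvStep_eq_e3OfS`, the dressed family being local by
an2's `locStencil_dressKBmAt` ∘ `locStencil_coProjBmAtK`). -/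
theorem e3OfK_coDressKBmAt_KInvStep_eq_e3OfS (hr : r ∈ box (d + 1) Lc) (hS : LocStencil S Cs δ) (hδ : 0 < δ) (j : ℕ)
    (κ' : Fin (d + 1)) (u' : Fin (d + 1) → ℤ) :
    e3OfK Lc (coDressKBmAt (toSite r) Lc (KInvStep (d := d) Lc j)) S κ' u'
      = e3OfS (Lc ^ (j + 1)) (fun κ z => ((((Lc : ℝ) ^ j) ^ (d + 2))⁻¹) •
          borderSum (Lc ^ j) (fun κ u => dressKBmAt (toSite r) Lc (coProjBmAtK (toSite r) Lc S κ u)) κ z) κ' u' := by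
  have hLc : 1 ≤ Lc := one_le_of_neZero Lc
  obtain ⟨δK, CK, hδK, _, hK⟩ := decays_KInvStep (d := d) (Lc := Lc) j
  have hDS := locStencil_dressKBmAt hLc hr (locStencil_coProjBmAtK hLc hr hS hδ.le) hδ.le
  rw [e3OfK_coDressKBmAt hLc hr hK hδK hS hδ κ' u']
  exact e3OfK_KInvStep_eq_e3OfS hDS hδ j κ' u'

/-- [folklore] **THE LITERAL OF RECORD, MEMBER BY MEMBER**: the cubic sector of member `j+1` of leaf-10's recursive first-order family — the functional
`e3OfK Lc G_j (SrecAt … j)` with `G_j = coDressKBmAt ρ Lc (KInvStep Lc j)` that `WardLocusRecursive.SrecAt_succ` weights by `cE·wE (j+1)` — IS the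
one-shot level-`(j+1)` `e3OfS` sandwich of the lifted, block-mean-dressed member `j` (in-block root `r`; locality of member `j` is leaf-10's
`locStencil_SrecAt`).  Road S3's OUTER object, for the D1 literal of record `RowD1JointEnd.JsRowD1` (whose `S`-tables are these, `SpineRecursiveW`). -/
theorem srecAt_cubic_eq_e3OfS (hr : r ∈ box (d + 1) Lc) (cE cVH cΛ : ℝ) (j : ℕ) :
    ∃ Cs δ : ℝ, 0 < δ ∧ LocStencil (SrecAt d Lc (toSite r) cE cVH cΛ j) Cs δ ∧
      ∀ (κ' : Fin (d + 1)) (u' : Fin (d + 1) → ℤ),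
        e3OfK Lc (coDressKBmAt (toSite r) Lc (KInvStep (d := d) Lc j)) (SrecAt d Lc (toSite r) cE cVH cΛ j) κ' u'
          = e3OfS (Lc ^ (j + 1)) (fun κ z => ((((Lc : ℝ) ^ j) ^ (d + 2))⁻¹) •
              borderSum (Lc ^ j) (fun κ u => dressKBmAt (toSite r) Lc
                (coProjBmAtK (toSite r) Lc (SrecAt d Lc (toSite r) cE cVH cΛ j) κ u)) κ z) κ' u' := by
  obtain ⟨Cs, δ, hδ, hS⟩ := locStencil_SrecAt (d := d) (Lc := Lc) (one_le_of_neZero Lc) hr cE cVH cΛ j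
  exact ⟨Cs, δ, hδ, hS, fun κ' u' => e3OfK_coDressKBmAt_KInvStep_eq_e3OfS hr hS hδ j κ' u'⟩

end Balaban

end Summit.QuantumFields.BalabanUV.Beta.GAN24.CubicReadoutCoDressed

end
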